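import Mathlib.Analysis.SpecialFunctions.Integrals.Basic
import Mathlib.Analysis.SpecialFunctions.ImproperIntegrals
import Mathlib.Analysis.SpecialFunctions.Trigonometric.InverseDeriv
import Mathlib.MeasureTheory.Measure.Lebesgue.Integral
import Mathlib.MeasureTheory.Integral.Prod
import HarnessLib

/-!
# The area `π/6` of Gauss's fundamental domain in Bhargava–Shankar's coordinates `(u, t)`:
# `∫∫_{|u| ≤ 1/2, u² + t⁴ ≥ 1, t > 0} t⁻³ du dt = π/6` (the `N'A'` factor of `Vol(𝓕) = ζ(2)`)

`Proofs` companion (theorems only: no definitions, no named facts) on the archimedean volume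
constant of M. Bhargava, A. Shankar, *Binary quartic forms having bounded invariants, and the
boundedness of the average rank of elliptic curves*, Ann. of Math. (2) 181 (2015) 191–242, §2.1 and
§2.4 (held arXiv text `arXiv:1006.1002v2`, pp. 9–12; published version §2.1, §2.3–2.4).

Bhargava–Shankar write Gauss's fundamental domain for `GL₂(ℤ)\GL₂(ℝ)` as
`𝓕 = {n(u) α(t) k λ : n(u) ∈ N'(t), α(t) ∈ A', k ∈ K, λ ∈ Λ}` with `n(u) = (1 0; u 1)`,
`α(t) = diag(t⁻¹, t)`, "`ν(t)` a union of one or two subintervals of `[−½, ½]`", and use the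
Haar measure `dg = t⁻² dn d^×t dk (d^×λ)`, `d^×t = dt/t` (§2.1, §2.3). In the coordinates of
the tree's `BinaryQuarticReductionProofs` (`iwasawa_eq`, `gaussDomain_bounds`: the point
`(mᵀ)⁻¹ · i = −u + t² i` of `ℍ`) the conditions `|u| ≤ ½`, `|−u + t² i| ≥ 1` read `|u| ≤ ½`,
`u² + t⁴ ≥ 1`, so the `N'A'` part of `𝓕` is the region
`G = {(u, t) : |u| ≤ ½, t > 0, u² + t⁴ ≥ 1}` with the measure `t⁻² du dt/t = t⁻³ du dt`. This file
computes its mass: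

* `BhargavaShankar.lintegral_gaussRegion` — `∫⁻_{G} t⁻³ = π/6` (as an `ℝ≥0∞`-valued integral of
  `ENNReal.ofReal (t ^ (−3))` for the Lebesgue measure on `ℝ × ℝ`);
* `BhargavaShankar.integral_gaussRegion`, `BhargavaShankar.integrableOn_gaussRegion` — the same
  as a Bochner integral, `∫_{G} t⁻³ du dt = π/6`.

(The substitution `y = t²`, `x = −u` turns `t⁻³ du dt` into `½ · dx dy/y²`, and `π/6` is half of
the hyperbolic area `π/3` of the standard fundamental domain in `ℍ`; cf.
`Literature/NumberTheory/Automorphic/HyperbolicLaplaceSpectrum.lean`, `volume_modular_fd`.)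
With the `N̄AN`-normalised Haar measure of Prop. 2.7 of the held text (v2: constant `2/27`;
`dg = t⁻² dū d^×t dθ` in the coordinates `n̄ a(t) k(θ)`, `θ` the angle), the compact factor
`K/{±1}` has mass `π`, which gives the constant `Vol(SL₂(ℤ)\SL₂(ℝ)) = (π/6)·π = π²/6 = ζ(2)` of
eq. (18) (`= 2ζ(2)` for `PGL₂(ℤ)\PGL₂(ℝ)` and the form `ω` of the published Prop. 2.8, whose
constant is `1/27`). Only the `(u, t)`-integral is formalised here.

## Proof

Tonelli on `ℝ × ℝ`: for `|u| ≤ ½` the fibre of `G` is `t ≥ (1 − u²)^{1/4}` and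
`∫_{(1−u²)^{1/4}}^∞ t⁻³ dt = 1/(2√(1 − u²))`; then `∫_{−½}^{½} du/(2√(1−u²)) = (arcsin ½ − arcsin(−½))/2
= π/6`.

## References

* M. Bhargava, A. Shankar, Ann. of Math. (2) 181 (2015) 191–242 = arXiv:1006.1002, §2.1 (the
  fundamental domain `𝓕 = N'A'KΛ`, the measure `t⁻² dn d^×t dk`), §2.4 eq. (18)
  (`Vol(𝓕_{SL₂}) = ζ(2)`; arXiv v2 numbering). [cite: BhargavaShankarAnnals2015, §2.1 and §2.4 eq. (18) (arXiv:1006.1002v2 numbering)]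
-/

noncomputable section

open MeasureTheory Set Real
open scoped ENNReal

namespace Literature.NumberTheory.EllipticCurves

namespace BhargavaShankar

/-! ## One-dimensional integrals -/

/-- `u ↦ 1/(2√(1-u²))` is continuous on `[-1/2, 1/2]`. [folklore] -/
theorem continuousOn_one_div_two_sqrt_one_sub_sq :
    ContinuousOn (fun u : ℝ ↦ 1 / (2 * Real.sqrt (1 - u ^ 2))) (Icc (-(1 / 2 : ℝ)) (1 / 2)) := by
  apply ContinuousOn.div continuousOn_const
  · exact (continuous_const.mul (Real.continuous_sqrt.comp (by fun_prop))).continuousOn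
  · intro u hu
    have : 0 < 1 - u ^ 2 := by nlinarith [hu.1, hu.2]
    exact mul_ne_zero two_ne_zero (Real.sqrt_pos.mpr this).ne'

/-- `∫_{-1/2}^{1/2} du/(2√(1-u²)) = (arcsin(1/2) − arcsin(−1/2))/2 = π/6` (cf. the hyperbolic
`∫_{-1/2}^{1/2} dx/√(1-x²) = π/3`, `Literature.NumberTheory.Automorphic.integral_one_div_sqrt_one_sub_sq`).
[folklore] -/
theorem integral_one_div_two_sqrt_one_sub_sq :
    ∫ u in Icc (-(1 / 2 : ℝ)) (1 / 2), 1 / (2 * Real.sqrt (1 - u ^ 2)) = π / 6 := by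
  have harc : Real.arcsin (1 / 2) = π / 6 := by
    rw [← Real.sin_pi_div_six]
    exact Real.arcsin_sin (by linarith [Real.pi_pos]) (by linarith [Real.pi_pos])
  have hderiv : ∀ u ∈ uIcc (-(1 / 2 : ℝ)) (1 / 2),
      HasDerivAt (fun u ↦ Real.arcsin u / 2) (1 / (2 * Real.sqrt (1 - u ^ 2))) u := by
    intro u hu
    rw [uIcc_of_le (by norm_num)] at hu
    have h1 : u ≠ -1 := by linarith [hu.1]
    have h2 : u ≠ 1 := by linarith [hu.2]
    exact ((Real.hasDerivAt_arcsin h1 h2).div_const 2).congr_deriv (by rw [div_div, mul_comm])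
  rw [integral_Icc_eq_integral_Ioc, ← intervalIntegral.integral_of_le (by norm_num),
    intervalIntegral.integral_eq_sub_of_hasDerivAt hderiv]
  · rw [Real.arcsin_neg, harc]; ring
  · apply ContinuousOn.intervalIntegrable
    rw [uIcc_of_le (by norm_num)]
    exact continuousOn_one_div_two_sqrt_one_sub_sq

/-- The fourth root `τ(u) = (1 − u²)^{1/4}` for `|u| ≤ 1/2`: positive, `τ⁴ = 1 − u²`, `τ² = √(1 − u²)`.
[folklore] -/
theorem fourthRoot_props {u : ℝ} (hu : |u| ≤ 1 / 2) :
    0 < (1 - u ^ 2) ^ (1 / 4 : ℝ) ∧ ((1 - u ^ 2) ^ (1 / 4 : ℝ)) ^ 4 = 1 - u ^ 2 ∧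
      ((1 - u ^ 2) ^ (1 / 4 : ℝ)) ^ 2 = Real.sqrt (1 - u ^ 2) := by
  have hu2 : u ^ 2 ≤ 1 / 4 := by
    have := abs_le.mp hu
    nlinarith
  have h0 : 0 < 1 - u ^ 2 := by linarith
  refine ⟨Real.rpow_pos_of_pos h0 _, ?_, ?_⟩
  · rw [← Real.rpow_natCast, ← Real.rpow_mul h0.le]; norm_num
  · rw [← Real.rpow_natCast, ← Real.rpow_mul h0.le, Real.sqrt_eq_rpow]; norm_num

/-- The fibre integral: `∫_{τ}^∞ t⁻³ dt = 1/(2τ²) = 1/(2√(1-u²))` for `τ = (1 − u²)^{1/4}`,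
`|u| ≤ 1/2`. [folklore] -/
theorem lintegral_Ioi_rpow_neg_three {u : ℝ} (hu : |u| ≤ 1 / 2) :
    ∫⁻ t in Ioi ((1 - u ^ 2) ^ (1 / 4 : ℝ)), ENNReal.ofReal (t ^ (-3 : ℝ)) =
      ENNReal.ofReal (1 / (2 * Real.sqrt (1 - u ^ 2))) := by
  obtain ⟨hτ, -, hτ2⟩ := fourthRoot_props hu
  rw [← ofReal_integral_eq_lintegral_ofReal (integrableOn_Ioi_rpow_of_lt (by norm_num) hτ)]
  · rw [integral_Ioi_rpow_of_lt (by norm_num) hτ]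
    congr 1
    have : (-3 : ℝ) + 1 = -2 := by norm_num
    rw [this, Real.rpow_neg hτ.le, Real.rpow_two, hτ2]
    field_simp
  · filter_upwards [ae_restrict_mem measurableSet_Ioi] with t ht
    exact Real.rpow_nonneg (hτ.trans ht).le _

/-! ## The region `G = {|u| ≤ 1/2, t > 0, u² + t⁴ ≥ 1}` and its fibres -/

/-- `G` is measurable. [folklore] -/
theorem measurableSet_gaussRegion :
    MeasurableSet {p : ℝ × ℝ | |p.1| ≤ 1 / 2 ∧ 0 < p.2 ∧ 1 ≤ p.1 ^ 2 + p.2 ^ 4} := by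
  simp only [setOf_and]
  refine (measurableSet_le (by fun_prop) measurable_const).inter
    ((measurableSet_lt measurable_const measurable_snd).inter
      (measurableSet_le measurable_const (by fun_prop)))

/-- The fibre of `G` over `u` with `|u| ≤ 1/2` is `[τ(u), ∞)`, `τ(u) = (1 − u²)^{1/4}`. [folklore] -/
theorem mem_gaussRegion_iff {u : ℝ} (hu : |u| ≤ 1 / 2) (t : ℝ) :
    (u, t) ∈ {p : ℝ × ℝ | |p.1| ≤ 1 / 2 ∧ 0 < p.2 ∧ 1 ≤ p.1 ^ 2 + p.2 ^ 4} ↔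
      (1 - u ^ 2) ^ (1 / 4 : ℝ) ≤ t := by
  obtain ⟨hτ, hτ4, -⟩ := fourthRoot_props hu
  simp only [mem_setOf_eq]
  constructor
  · rintro ⟨-, ht, h1⟩
    have h4 : ((1 - u ^ 2) ^ (1 / 4 : ℝ)) ^ 4 ≤ t ^ 4 := by rw [hτ4]; linarith
    exact le_of_pow_le_pow_left₀ (by norm_num) ht.le h4
  · intro h
    have ht : 0 < t := hτ.trans_le h
    refine ⟨hu, ht, ?_⟩
    have h4 : ((1 - u ^ 2) ^ (1 / 4 : ℝ)) ^ 4 ≤ t ^ 4 := pow_le_pow_left₀ hτ.le h 4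
    rw [hτ4] at h4
    linarith

/-! ## The area `π/6` -/

/-- **`∫∫_{|u| ≤ 1/2, t > 0, u² + t⁴ ≥ 1} t⁻³ du dt = π/6`** (Lebesgue measure on `ℝ × ℝ`,
`ℝ≥0∞`-valued form): the mass of the `N'A'` part of Gauss's fundamental domain for Bhargava–Shankar's
measure `t⁻² dn d^×t`. [cite: BhargavaShankarAnnals2015, §2.1 and §2.4 eq. (18) (arXiv:1006.1002v2 numbering)] -/
theorem lintegral_gaussRegion :
    ∫⁻ p in {p : ℝ × ℝ | |p.1| ≤ 1 / 2 ∧ 0 < p.2 ∧ 1 ≤ p.1 ^ 2 + p.2 ^ 4},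
        ENNReal.ofReal (p.2 ^ (-3 : ℝ)) = ENNReal.ofReal (π / 6) := by
  set G := {p : ℝ × ℝ | |p.1| ≤ 1 / 2 ∧ 0 < p.2 ∧ 1 ≤ p.1 ^ 2 + p.2 ^ 4} with hG
  have hGm : MeasurableSet G := measurableSet_gaussRegion
  set g : ℝ × ℝ → ℝ≥0∞ := fun p ↦ ENNReal.ofReal (p.2 ^ (-3 : ℝ)) with hg
  have hgm : Measurable g := by
    simp only [hg]
    exact ENNReal.measurable_ofReal.comp (measurable_snd.pow_const _)
  rw [← lintegral_indicator hGm, Measure.volume_eq_prod,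
    lintegral_prod _ (hgm.indicator hGm).aemeasurable]
  -- the fibres
  have inner : ∀ u : ℝ, ∫⁻ t, G.indicator g (u, t) =
      (Icc (-(1 / 2 : ℝ)) (1 / 2)).indicator
        (fun u ↦ ENNReal.ofReal (1 / (2 * Real.sqrt (1 - u ^ 2)))) u := by
    intro u
    by_cases hu : |u| ≤ 1 / 2
    · have huI : u ∈ Icc (-(1 / 2 : ℝ)) (1 / 2) := by
        rcases abs_le.mp hu with ⟨h1, h2⟩; exact ⟨h1, h2⟩
      rw [indicator_of_mem huI, ← lintegral_Ioi_rpow_neg_three hu,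
        setLIntegral_congr (Ioi_ae_eq_Ici (a := (1 - u ^ 2) ^ (1 / 4 : ℝ))),
        ← lintegral_indicator measurableSet_Ici]
      apply lintegral_congr
      intro t
      by_cases ht : (1 - u ^ 2) ^ (1 / 4 : ℝ) ≤ t
      · have hmem : (u, t) ∈ G := (mem_gaussRegion_iff hu t).mpr ht
        rw [indicator_of_mem hmem, indicator_of_mem (mem_Ici.mpr ht)]
      · have hnmem : (u, t) ∉ G := fun h ↦ ht ((mem_gaussRegion_iff hu t).mp h)
        rw [indicator_of_notMem hnmem, indicator_of_notMem (by simpa using ht)]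
    · have huI : u ∉ Icc (-(1 / 2 : ℝ)) (1 / 2) := fun h ↦ hu (abs_le.mpr ⟨h.1, h.2⟩)
      rw [indicator_of_notMem huI]
      have : ∀ t, G.indicator g (u, t) = 0 := fun t ↦
        indicator_of_notMem (fun h ↦ hu h.1) _
      simp [this]
  simp_rw [inner]
  rw [lintegral_indicator measurableSet_Icc, ← ofReal_integral_eq_lintegral_ofReal ?_ ?_,
    integral_one_div_two_sqrt_one_sub_sq]
  · exact continuousOn_one_div_two_sqrt_one_sub_sq.integrableOn_Icc
  · filter_upwards [ae_restrict_mem measurableSet_Icc] with u hu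
    exact div_nonneg zero_le_one (mul_nonneg zero_le_two (Real.sqrt_nonneg _))

/-- `t⁻³` is integrable on `G`. [folklore] -/
theorem integrableOn_gaussRegion :
    IntegrableOn (fun p : ℝ × ℝ ↦ p.2 ^ (-3 : ℝ))
      {p : ℝ × ℝ | |p.1| ≤ 1 / 2 ∧ 0 < p.2 ∧ 1 ≤ p.1 ^ 2 + p.2 ^ 4} := by
  have hGm := measurableSet_gaussRegion
  refine ⟨(measurable_snd.pow_const _).aestronglyMeasurable, ?_⟩
  rw [hasFiniteIntegral_iff_ofReal]
  · rw [lintegral_gaussRegion]; exact ENNReal.ofReal_lt_top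
  · filter_upwards [ae_restrict_mem hGm] with p hp
    exact Real.rpow_nonneg hp.2.1.le _

/-- **`∫∫_{|u| ≤ 1/2, t > 0, u² + t⁴ ≥ 1} t⁻³ du dt = π/6`** (Bochner integral): the `N'A'` factor
of Bhargava–Shankar's `Vol(𝓕_{SL₂}) = ζ(2) = (π/6)·π` (eq. (18) of the held text), in the
coordinates `n(u) α(t)`, `α(t) = diag(t⁻¹, t)`, measure `t⁻² du d^×t`.
[cite: BhargavaShankarAnnals2015, §2.1 and §2.4 eq. (18) (arXiv:1006.1002v2 numbering)] -/
theorem integral_gaussRegion :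
    ∫ p in {p : ℝ × ℝ | |p.1| ≤ 1 / 2 ∧ 0 < p.2 ∧ 1 ≤ p.1 ^ 2 + p.2 ^ 4}, p.2 ^ (-3 : ℝ) = π / 6 := by
  have hGm := measurableSet_gaussRegion
  rw [integral_eq_lintegral_of_nonneg_ae ?_ (measurable_snd.pow_const _).aestronglyMeasurable,
    lintegral_gaussRegion, ENNReal.toReal_ofReal (by positivity)]
  filter_upwards [ae_restrict_mem hGm] with p hp
  exact Real.rpow_nonneg hp.2.1.le _

/-- The same with the density written `t⁻² · t⁻¹` (`t⁻² du d^×t`). [folklore] -/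
theorem integral_gaussRegion' :
    ∫ p in {p : ℝ × ℝ | |p.1| ≤ 1 / 2 ∧ 0 < p.2 ∧ 1 ≤ p.1 ^ 2 + p.2 ^ 4}, (p.2 ^ 2)⁻¹ * p.2⁻¹ =
      π / 6 := by
  rw [← integral_gaussRegion]
  refine setIntegral_congr_fun measurableSet_gaussRegion fun p hp ↦ ?_
  have ht : 0 < p.2 := hp.2.1
  rw [Real.rpow_neg ht.le, show (3 : ℝ) = (3 : ℕ) by norm_num, Real.rpow_natCast]
  field_simp

/-- `ζ(2) = π²/6 = (π/6) · π`: the area of the `(u,t)`-region times the mass `π` of `K/{±1}`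
(`dk = dθ`). [folklore] -/
theorem pi_sq_div_six_eq : Real.pi ^ 2 / 6 = (π / 6) * π := by ring

end BhargavaShankar

end Literature.NumberTheory.EllipticCurves

end
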